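import Literature.Geometry.Lorentzian.KerrTimeDominatedCurrent
import Literature.Geometry.Lorentzian.KerrSeparatedPotentialBounds
import Literature.Geometry.Lorentzian.KerrFrequencyRanges
import Literature.Geometry.Lorentzian.KerrTortoiseRadius
import HarnessLib

/-!
# The multiplier estimate of the time-dominated range `𝓖_♯` for Carter's radial ODE on Kerr
# (Dafermos–Rodnianski–Shlapentokh-Rothman, Proposition 8.4.1)

(family `gr`, infrastructure for statement **gr.S24**; namespace `Literature.Geometry.Lorentzian.Kerr`)

Dafermos–Rodnianski–Shlapentokh-Rothman (*Decay for solutions of the wave equation on Kerr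
exterior spacetimes III*, arXiv:1402.7034 = Ann. of Math. 183 (2016)), Proposition 8.4.1: for
`a₀ < M`, all `ω_high`, `ε_width⁻¹`, `R_∞` sufficiently big, all `E ≥ 2`, `0 ≤ a ≤ a₀` and
`(ω, m, Λ) ∈ 𝓖_♯(ω_high, ε_width)` (admissible, `|ω| ≥ ω_high`, `Λ < ε_width ω²`,
non-superradiant) there is a function `y` with `|y| ≤ B`, `y = 1` for `r* ≥ R*_∞`, such that every
smooth solution `u` of `u'' + (ω² − V)u = H` (`' = d/dr*`, `V` Carter's potential) with the
boundary conditions (eq:b−), (eq:b+) satisfies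
`b ∫_{R*₋}^{R*₊} (|u'|² + (ω² + Λ)|u|²) ≤ ∫_{−∞}^{∞} (−2y Re(u'H̄) + Eω Im(Hū))`.
The proof: `Q = ϟ^y − E·Q^T` with `½ ≤ y ≤ 1`, `y' ≥ 0`, `y(−∞) = ½`, `y = 1` for `r* ≥ R*_dec`;
the bulk `y'(|u'|² + (ω² − V)|u|²) − yV'|u|²` is non-negative by the bounds (someBoundS) on `V`,
`V'` (with `Λ ≤ ε_width ω²`, `ω² ≥ ω²_high`) and (decrease) (`V' < 0` for `r* ≥ R*_dec`), and the
boundary terms have the good sign.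

This file **proves** the proposition in the following explicit form (`timeDominated_estimate_kerr`),
for `|a| < M` and a *tortoise radius function* `R = r ∘ (r*)⁻¹` (`IsTortoiseRadius` of
`KerrTortoiseRadius.lean`: `dR/dx = Δ(R)/(R² + a²)`, `R > r₊`, `R(−∞) = r₊`, `R(+∞) = ∞` — DRSR
§2.1.2, (rstar), up to the additive normalisation of `r*`; such `R` exist,
`exists_isTortoiseRadius`), with `V(x) = V_{(ω,m,Λ)}(R(x))` the potential of
`KerrSeparatedPotential.lean`:

* the weight is `y = Y ∘ R`, `Y(r) = 1 − max(R_d − r, 0)²/(2(R_d − r₊)²)` (`tdWeight`; `C¹`,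
  `Y(r₊) = ½`, `Y = 1` for `r ≥ R_d`, `0 ≤ dY/dr ≤ 1/(6M)`, `dY/dr ≥ M/R_d²` on `r ≤ R_d − M`), with a
  free decoupling radius `R_d ≥ 8M` in the role of `R_dec` (`dV/dr < 0` for `r ≥ 7M`,
  `KerrSeparatedPotentialBounds.deriv_sepPotential_neg_of_seven_mul_le`);
* "`ω_high`, `ε_width⁻¹` sufficiently big" is `ε_width ≤ 1`, `10³ ε_width R_d² ≤ M⁴` and
  `10⁴ R_d² ≤ M⁴ ω²_high`; `(ω, m, Λ)` is admissible with `ω_high ≤ |ω|`, `Λ ≤ ε_width ω²` and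
  non-superradiant, `ω(ω − ω₊m) ≥ 0` (for triples off the strip of §8.1 this is
  `mul_sub_nonneg_of_not_isNearSuperradiant`);
* the `r*`-interval `[x₁, x₂]` is any with `R(x₁) ≥ r₊ + δ`, `R(x₂) ≤ R_d − M` (`δ > 0`; for the
  `[R*₋, R*₊]` of loc. cit. take `R_d = max(8M, R₊ + M)` and `δ = R₋ − r₊`);
* the constant is `b = 3Mδ²/(16R_d⁴)`.

Ingredients: the abstract `ϟ^y − E·Q^T` argument (`KerrTimeDominatedCurrent.timeDominated_estimate`),
the potential bounds `|V| ≤ 3Λ/r² + 3M/r³`, `|dV/dr| ≤ 24Λ/r³ + 184M/r⁴` and (decrease) with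
`R_dec = 7M` (`KerrSeparatedPotentialBounds.lean`), `ω² − V(r₊) = (ω − ω₊m)²`
(`KerrSeparatedPotential.omega_sq_sub_sepPotential_rPlus`).

## References

* M. Dafermos, I. Rodnianski, Y. Shlapentokh-Rothman, arXiv:1402.7034 = Ann. of Math. 183
  (2016), §2.1.2 (rstar), §5.3 ((eq:b±)), §8.1 (`𝓖_♯`), §8.4 (Proposition 8.4.1 and its proof)
  (key `DafermosRodnianskiShlapentokhrothman2014`).
-/

noncomputable section

open scoped InnerProductSpace ComplexConjugate
open Filter Topology MeasureTheory Set

namespace Literature.Geometry.Lorentzian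

namespace Kerr

/-! ### The weight `Y` -/

/-- `d/dt max(t, 0)² = 2 max(t, 0)` everywhere (a `C¹` function). [folklore] -/
theorem hasDerivAt_max_zero_sq (t : ℝ) :
    HasDerivAt (fun s : ℝ ↦ max s 0 ^ 2) (2 * max t 0) t := by
  rcases lt_trichotomy t 0 with ht | rfl | ht
  · have h0 : (fun s : ℝ ↦ max s 0 ^ 2) =ᶠ[𝓝 t] fun _ ↦ (0 : ℝ) := by
      filter_upwards [Iio_mem_nhds ht] with s hs
      rw [max_eq_right (le_of_lt hs)]
      ring
    rw [max_eq_right ht.le, mul_zero]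
    exact (hasDerivAt_const t (0 : ℝ)).congr_of_eventuallyEq h0
  · rw [max_self, mul_zero, hasDerivAt_iff_isLittleO, Asymptotics.isLittleO_iff]
    intro c hc
    filter_upwards [Metric.ball_mem_nhds (0 : ℝ) hc] with s hs
    rw [Metric.mem_ball, Real.dist_eq, sub_zero] at hs
    have h1 : |max s 0| ≤ |s| := by
      rcases le_or_gt s 0 with h | h
      · rw [max_eq_right h]; simp
      · rw [max_eq_left h.le]
    have h2 : max s 0 ^ 2 - max 0 0 ^ 2 - (s - 0) • (0 : ℝ) = max s 0 ^ 2 := by simp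
    rw [h2, Real.norm_eq_abs, Real.norm_eq_abs, sub_zero, abs_pow]
    calc |max s 0| ^ 2 = |max s 0| * |max s 0| := by ring
      _ ≤ |s| * |s| := mul_le_mul h1 h1 (abs_nonneg _) (abs_nonneg _)
      _ ≤ c * |s| := mul_le_mul_of_nonneg_right hs.le (abs_nonneg _)
  · have h0 : (fun s : ℝ ↦ max s 0 ^ 2) =ᶠ[𝓝 t] fun s ↦ s ^ 2 := by
      filter_upwards [Ioi_mem_nhds ht] with s hs
      rw [max_eq_left (le_of_lt hs)]
    rw [max_eq_left ht.le]
    have h := hasDerivAt_pow 2 t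
    have h' : HasDerivAt (fun s : ℝ ↦ s ^ 2) (2 * t) t := h.congr_deriv (by norm_num)
    exact h'.congr_of_eventuallyEq h0

/-- `d/ds max(c − s, 0)² = −2 max(c − s, 0)`. [folklore] -/
theorem hasDerivAt_max_sub_zero_sq (c r : ℝ) :
    HasDerivAt (fun s : ℝ ↦ max (c - s) 0 ^ 2) (-(2 * max (c - r) 0)) r := by
  have h := (hasDerivAt_max_zero_sq (c - r)).comp r ((hasDerivAt_const r c).sub (hasDerivAt_id r))
  have h' : HasDerivAt ((fun s : ℝ ↦ max s 0 ^ 2) ∘ fun s ↦ c - id s) (2 * max (c - r) 0 * (0 - 1)) r :=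
    h
  refine (h'.congr_deriv (by ring)).congr_of_eventuallyEq (Eventually.of_forall fun s ↦ ?_)
  simp

/-- **The weight `Y(r) = 1 − max(R_d − r, 0)²/(2(R_d − r₊)²)`** of the time-dominated range, as a
function of `r`, with the decoupling radius `R_d` (`≥ 8M` below) as a parameter: `Y(r₊) = ½`,
`Y = 1` for `r ≥ R_d`, `dY/dr ≥ 0`, and `dY/dr ≥ M/R_d²` on `r ≤ R_d − M` — an explicit function
with the properties (someyStuff) required in the proof of DRSR arXiv:1402.7034, Prop. 8.4.1
("Such a `y` is trivial to construct"); there `y` is this `Y` read along `r*`, and `R_d` plays the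
role of `R_dec`. [cite: DafermosRodnianskiShlapentokhrothman2014, Prop. 8.4.1 (proof)] -/
def tdWeight (M a Rd r : ℝ) : ℝ :=
  1 - max (Rd - r) 0 ^ 2 / (2 * (Rd - rPlus M a) ^ 2)

/-- `dY/dr = max(R_d − r, 0)/(R_d − r₊)²`. [cite: DafermosRodnianskiShlapentokhrothman2014, Prop. 8.4.1 (proof)] -/
def tdWeightDeriv (M a Rd r : ℝ) : ℝ :=
  max (Rd - r) 0 / (Rd - rPlus M a) ^ 2

section Weight

variable {M a Rd r : ℝ}

/-- `6M ≤ R_d − r₊ ≤ R_d` for `0 < M`, `8M ≤ R_d` (as `0 ≤ M ≤ r₊ ≤ 2M`). [folklore] -/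
theorem tdWeight_den_bounds (hM : 0 < M) (hRd : 8 * M ≤ Rd) :
    6 * M ≤ Rd - rPlus M a ∧ Rd - rPlus M a ≤ Rd :=
  ⟨by linarith [rPlus_le_two_mul (a := a) hM.le], by linarith [M_le_rPlus M a]⟩

/-- `dY/dr` is the derivative of `Y`. [cite: DafermosRodnianskiShlapentokhrothman2014, Prop. 8.4.1 (proof)] -/
theorem hasDerivAt_tdWeight (M a Rd r : ℝ) :
    HasDerivAt (tdWeight M a Rd) (tdWeightDeriv M a Rd r) r := by
  have h := ((hasDerivAt_max_sub_zero_sq Rd r).div_const (2 * (Rd - rPlus M a) ^ 2)).const_sub 1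
  refine h.congr_deriv ?_
  unfold tdWeightDeriv
  rcases eq_or_ne (Rd - rPlus M a) 0 with h0 | h0
  · rw [h0]; simp
  · field_simp

/-- `Y(r₊) = ½` (`0 < M`, `8M ≤ R_d`). [cite: DafermosRodnianskiShlapentokhrothman2014, Prop. 8.4.1 (proof)] -/
theorem tdWeight_rPlus (hM : 0 < M) (hRd : 8 * M ≤ Rd) : tdWeight M a Rd (rPlus M a) = 1 / 2 := by
  have hd := (tdWeight_den_bounds (a := a) hM hRd).1
  have hpos : 0 < Rd - rPlus M a := by linarith
  unfold tdWeight
  rw [max_eq_left hpos.le]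
  field_simp
  ring

/-- `Y = 1` for `r ≥ R_d`. [cite: DafermosRodnianskiShlapentokhrothman2014, Prop. 8.4.1 (proof)] -/
theorem tdWeight_eq_one (hr : Rd ≤ r) : tdWeight M a Rd r = 1 := by
  unfold tdWeight
  rw [max_eq_right (by linarith)]
  simp

/-- `dY/dr = 0` for `r ≥ R_d`. [cite: DafermosRodnianskiShlapentokhrothman2014, Prop. 8.4.1 (proof)] -/
theorem tdWeightDeriv_eq_zero (hr : Rd ≤ r) : tdWeightDeriv M a Rd r = 0 := by
  unfold tdWeightDeriv
  rw [max_eq_right (by linarith)]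
  simp

/-- `dY/dr ≥ 0`. [cite: DafermosRodnianskiShlapentokhrothman2014, Prop. 8.4.1 (proof)] -/
theorem tdWeightDeriv_nonneg (M a Rd r : ℝ) : 0 ≤ tdWeightDeriv M a Rd r := by
  unfold tdWeightDeriv
  exact div_nonneg (le_max_right _ _) (sq_nonneg _)

/-- `dY/dr ≤ 1/(6M)` on `r ≥ r₊` (`0 < M`, `8M ≤ R_d`). [cite: DafermosRodnianskiShlapentokhrothman2014, Prop. 8.4.1 (proof)] -/
theorem tdWeightDeriv_le (hM : 0 < M) (hRd : 8 * M ≤ Rd) (hr : rPlus M a ≤ r) :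
    tdWeightDeriv M a Rd r ≤ 1 / (6 * M) := by
  obtain ⟨hd1, hd2⟩ := tdWeight_den_bounds (a := a) hM hRd
  have hpos : 0 < Rd - rPlus M a := by linarith
  unfold tdWeightDeriv
  have hmax : max (Rd - r) 0 ≤ Rd - rPlus M a := max_le (by linarith) hpos.le
  calc max (Rd - r) 0 / (Rd - rPlus M a) ^ 2
      ≤ (Rd - rPlus M a) / (Rd - rPlus M a) ^ 2 := by gcongr
    _ = 1 / (Rd - rPlus M a) := by field_simp
    _ ≤ 1 / (6 * M) := one_div_le_one_div_of_le (by positivity) hd1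

/-- `dY/dr ≥ M/R_d²` on `r ≤ R_d − M` (`0 < M`, `8M ≤ R_d`): there `max(R_d − r, 0) ≥ M` and
`R_d − r₊ ≤ R_d`. [cite: DafermosRodnianskiShlapentokhrothman2014, Prop. 8.4.1 (proof)] -/
theorem le_tdWeightDeriv (hM : 0 < M) (hRd : 8 * M ≤ Rd) (hr : r ≤ Rd - M) :
    M / Rd ^ 2 ≤ tdWeightDeriv M a Rd r := by
  obtain ⟨hd1, hd2⟩ := tdWeight_den_bounds (a := a) hM hRd
  have hpos : 0 < Rd - rPlus M a := by linarith
  unfold tdWeightDeriv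
  have hmax : M ≤ max (Rd - r) 0 := le_max_of_le_left (by linarith)
  calc M / Rd ^ 2 ≤ M / (Rd - rPlus M a) ^ 2 := by
        apply div_le_div_of_nonneg_left hM.le (by positivity)
        exact pow_le_pow_left₀ hpos.le hd2 2
    _ ≤ max (Rd - r) 0 / (Rd - rPlus M a) ^ 2 := by gcongr

/-- `½ ≤ Y ≤ 1` on `r ≥ r₊` (`0 < M`, `8M ≤ R_d`). [cite: DafermosRodnianskiShlapentokhrothman2014, Prop. 8.4.1 (proof)] -/
theorem tdWeight_mem_Icc (hM : 0 < M) (hRd : 8 * M ≤ Rd) (hr : rPlus M a ≤ r) :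
    tdWeight M a Rd r ∈ Icc (1 / 2) 1 := by
  obtain ⟨hd1, hd2⟩ := tdWeight_den_bounds (a := a) hM hRd
  have hpos : 0 < Rd - rPlus M a := by linarith
  have hmax : max (Rd - r) 0 ≤ Rd - rPlus M a := max_le (by linarith) hpos.le
  have hmax0 : 0 ≤ max (Rd - r) 0 := le_max_right _ _
  have hsq : max (Rd - r) 0 ^ 2 ≤ (Rd - rPlus M a) ^ 2 := pow_le_pow_left₀ hmax0 hmax 2
  have hq : max (Rd - r) 0 ^ 2 / (2 * (Rd - rPlus M a) ^ 2) ≤ 1 / 2 := by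
    rw [div_le_iff₀ (by positivity)]
    linarith
  have hq0 : 0 ≤ max (Rd - r) 0 ^ 2 / (2 * (Rd - rPlus M a) ^ 2) := by positivity
  unfold tdWeight
  constructor <;> linarith

/-- `Y` is continuous. [folklore] -/
theorem continuous_tdWeight (M a Rd : ℝ) : Continuous (tdWeight M a Rd) :=
  continuous_iff_continuousAt.2 fun r ↦ (hasDerivAt_tdWeight M a Rd r).continuousAt

end Weight

/-! ### Non-superradiance off the strip -/

/-- Off the near-superradiant strip `mω ∈ (0, ω₊m² + αΛ]` (`α ≥ 0`, `Λ ≥ 0`, `ω₊ ≥ 0`) a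
frequency is non-superradiant: `ω(ω − ω₊m) ≥ 0`. (Either `mω ≤ 0`, and then `ω₊mω ≤ 0 ≤ ω²`; or
`mω > ω₊m²`, and then `ω` and `ω − ω₊m` have the sign of `m`.) DRSR arXiv:1402.7034, §8.4 ("The
regime is manifestly non-superradiant"). [cite: DafermosRodnianskiShlapentokhrothman2014, §8.4] -/
theorem mul_sub_nonneg_of_not_isNearSuperradiant {M a α ω Λ : ℝ} {m : ℤ} (hM : 0 ≤ M)
    (ha0 : 0 ≤ a) (hα : 0 ≤ α) (hΛ : 0 ≤ Λ) (h : ¬ IsNearSuperradiant M a α ω m Λ) :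
    0 ≤ ω * (ω - horizonAngularVelocity M a * m) := by
  have hp : 0 ≤ horizonAngularVelocity M a := horizonAngularVelocity_nonneg hM ha0
  unfold IsNearSuperradiant at h
  rw [not_and_or, not_lt, not_le] at h
  rcases h with h | h
  · -- `mω ≤ 0`
    have : horizonAngularVelocity M a * ((m : ℝ) * ω) ≤ 0 := mul_nonpos_of_nonneg_of_nonpos hp h
    nlinarith [sq_nonneg ω]
  · -- `mω > ω₊ m² + αΛ ≥ ω₊ m²`
    have h1 : horizonAngularVelocity M a * (m : ℝ) ^ 2 < (m : ℝ) * ω := by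
      nlinarith [mul_nonneg hα hΛ]
    -- `m (ω − ω₊ m) > 0`, so `ω − ω₊m` and `ω` have the sign of `m`
    have h2 : 0 < (m : ℝ) * (ω - horizonAngularVelocity M a * m) := by nlinarith
    have h3 : 0 < (m : ℝ) * ω := by nlinarith [mul_nonneg hp (sq_nonneg (m : ℝ))]
    -- product of two quantities each with the sign of `m`
    have h4 : 0 < ((m : ℝ) * ω) * ((m : ℝ) * (ω - horizonAngularVelocity M a * m)) :=
      mul_pos h3 h2
    have hm0 : (m : ℝ) ≠ 0 := by
      rintro h0
      rw [h0, zero_mul] at h3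
      exact lt_irrefl _ h3
    have hm2 : 0 < (m : ℝ) ^ 2 := by positivity
    have h5 : 0 < (m : ℝ) ^ 2 * (ω * (ω - horizonAngularVelocity M a * m)) := by nlinarith
    -- `0 < m² X` with `m² > 0` gives `X ≥ 0`
    nlinarith

/-! ### The potential along a tortoise radius function -/

section Potential

variable {M a ω Λ : ℝ} {m : ℤ} {R : ℝ → ℝ}

/-- `V ∘ R` is differentiable with `(V ∘ R)' = (dV/dr)(R) · Δ(R)/(R² + a²)`. [cite: DafermosRodnianskiShlapentokhrothman2014, §5.2.3] -/
theorem hasDerivAt_sepPotential_comp (hR : IsTortoiseRadius M a R) (hMa : IsSubextremal M a)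
    (x : ℝ) :
    HasDerivAt (fun t ↦ sepPotential M a ω m Λ (R t))
      (deriv (sepPotential M a ω m Λ) (R x) * (delta M a (R x) / (R x ^ 2 + a ^ 2))) x := by
  have hD := (hR.sq_add_sq_pos hMa x).ne'
  have h := (hasDerivAt_sepPotential M a ω m Λ hD).comp x (hR.hasDerivAt x)
  rw [deriv_sepPotential_eq M a ω m Λ hD]
  exact h

/-- `V(R(x)) → V(r₊) = ω² − (ω − ω₊m)²` as `x → −∞`. DRSR arXiv:1402.7034, Lemma 6.3.2 and §8.4
(the horizon boundary term). [cite: DafermosRodnianskiShlapentokhrothman2014, §8.4] -/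
theorem tendsto_sepPotential_comp_atBot (hR : IsTortoiseRadius M a R) (hMa : IsSubextremal M a) :
    Tendsto (fun t ↦ sepPotential M a ω m Λ (R t)) atBot
      (𝓝 (ω ^ 2 - (ω - horizonAngularVelocity M a * m) ^ 2)) := by
  have hM := hMa.pos
  have hr : 0 < rPlus M a := hM.trans_le (M_le_rPlus M a)
  have hD : rPlus M a ^ 2 + a ^ 2 ≠ 0 := by positivity
  have hc : ContinuousAt (sepPotential M a ω m Λ) (rPlus M a) :=
    (hasDerivAt_sepPotential M a ω m Λ hD).continuousAt
  have hval : sepPotential M a ω m Λ (rPlus M a) =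
      ω ^ 2 - (ω - horizonAngularVelocity M a * m) ^ 2 := by
    have h := omega_sq_sub_sepPotential_rPlus (le_of_lt hMa) hM ω m Λ
    have h2 : (2 * M * rPlus M a * ω - a * m) ^ 2 / (4 * M ^ 2 * rPlus M a ^ 2) =
        (ω - horizonAngularVelocity M a * m) ^ 2 := by
      unfold horizonAngularVelocity
      have h2M : 2 * M * rPlus M a ≠ 0 := by positivity
      rw [div_eq_iff (by positivity)]
      field_simp
      ring
    linarith
  rw [← hval]
  exact hc.tendsto.comp hR.tendsto_atBot

/-- `V(R(x)) → 0` as `x → +∞` (from `|V| ≤ 3Λ/r² + 3M/r³`). [cite: DafermosRodnianskiShlapentokhrothman2014, §8.4] -/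
theorem tendsto_sepPotential_comp_atTop (hR : IsTortoiseRadius M a R) (hMa : IsSubextremal M a)
    (hadm : IsAdmissibleTriple a ω m Λ) :
    Tendsto (fun t ↦ sepPotential M a ω m Λ (R t)) atTop (𝓝 0) := by
  have hM := hMa.pos
  have hΛ := hadm.nonneg
  -- `|V(R)| ≤ (3Λ + 3M)/R` once `R ≥ 1`
  have hbound : ∀ᶠ t in atTop, ‖sepPotential M a ω m Λ (R t)‖ ≤ (3 * Λ + 3 * M) * (R t)⁻¹ := by
    filter_upwards [hR.eventually_le 1] with t ht
    have hr : rPlus M a ≤ R t := (hR.rPlus_lt t).le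
    have hr0 : 0 < R t := hR.pos hMa t
    have h := abs_sepPotential_le hM (le_of_lt hMa) hadm hr
    rw [Real.norm_eq_abs]
    refine h.trans ?_
    have h1 : 3 * Λ / R t ^ 2 ≤ 3 * Λ * (R t)⁻¹ := by
      rw [div_eq_mul_inv]
      apply mul_le_mul_of_nonneg_left _ (by positivity)
      exact inv_anti₀ hr0 (by nlinarith)
    have h2 : 3 * M / R t ^ 3 ≤ 3 * M * (R t)⁻¹ := by
      rw [div_eq_mul_inv]
      apply mul_le_mul_of_nonneg_left _ (by positivity)
      exact inv_anti₀ hr0 (by nlinarith)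
    linarith
  have hlim : Tendsto (fun t ↦ (3 * Λ + 3 * M) * (R t)⁻¹) atTop (𝓝 0) := by
    have h := (tendsto_inv_atTop_zero.comp hR.tendsto_atTop).const_mul (3 * Λ + 3 * M)
    simpa only [Function.comp_def, mul_zero] using h
  exact squeeze_zero_norm' hbound hlim

end Potential

/-! ### The pointwise sign of the bulk -/

section Bulk

variable {M a ω Λ ε ωh Rd : ℝ} {m : ℤ}

/-- **Smallness of `V` in `𝓖_♯`**: for an admissible triple with `Λ ≤ ε ω²`, `ω_high ≤ |ω|`, and
`10⁴ε ≤ M²`, `10⁵ ≤ M²ω²_high`, one has `|V(r)| ≤ ω²/4` on `r ≥ r₊`. DRSR arXiv:1402.7034, §8.4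
((someBoundS) combined with `ω² > ε⁻¹_width Λ`). [cite: DafermosRodnianskiShlapentokhrothman2014, Prop. 8.4.1 (proof)] -/
theorem abs_sepPotential_le_quarter (hMa : IsSubextremal M a) (hadm : IsAdmissibleTriple a ω m Λ)
    (hΛ : Λ ≤ ε * ω ^ 2) (hωh0 : 0 ≤ ωh) (hωh : ωh ≤ |ω|) (hε : 10 ^ 4 * ε ≤ M ^ 2)
    (hωh' : 10 ^ 5 ≤ M ^ 2 * ωh ^ 2) {r : ℝ} (hr : rPlus M a ≤ r) :
    |sepPotential M a ω m Λ r| ≤ ω ^ 2 / 4 := by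
  have hM := hMa.pos
  have hMr : M ≤ r := (M_le_rPlus M a).trans hr
  have hr0 : 0 < r := hM.trans_le hMr
  have hΛ0 := hadm.nonneg
  have hω2 : ωh ^ 2 ≤ ω ^ 2 := by
    calc ωh ^ 2 ≤ |ω| ^ 2 := pow_le_pow_left₀ hωh0 hωh 2
      _ = ω ^ 2 := sq_abs ω
  have h := abs_sepPotential_le hM (le_of_lt hMa) hadm hr
  -- `3Λ/r² ≤ 3Λ/M² ≤ 3εω²/M²` and `3M/r³ ≤ 3/M² ≤ 3ω²/(M²ω_h²)·…`
  have h1 : 3 * Λ / r ^ 2 ≤ 3 * Λ / M ^ 2 :=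
    div_le_div_of_nonneg_left (by positivity) (by positivity) (pow_le_pow_left₀ hM.le hMr 2)
  have h2 : 3 * M / r ^ 3 ≤ 3 * M / M ^ 3 :=
    div_le_div_of_nonneg_left (by positivity) (by positivity) (pow_le_pow_left₀ hM.le hMr 3)
  have h2' : 3 * M / M ^ 3 = 3 / M ^ 2 := by field_simp
  -- `3Λ/M² ≤ 3εω²/M² ≤ 3·10⁻⁴ ω²`
  have hω0 : 0 ≤ ω ^ 2 := sq_nonneg ω
  have h3 : 3 * Λ / M ^ 2 ≤ 3 * ω ^ 2 / 10 ^ 4 := by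
    rw [div_le_div_iff₀ (by positivity) (by positivity)]
    nlinarith [mul_le_mul_of_nonneg_right hε hω0]
  -- `3/M² ≤ 3ω²/10⁵` since `10⁵ ≤ M²ω_h² ≤ M²ω²`
  have h4 : 3 / M ^ 2 ≤ 3 * ω ^ 2 / 10 ^ 5 := by
    rw [div_le_div_iff₀ (by positivity) (by positivity)]
    nlinarith [mul_le_mul_of_nonneg_left hω2 (sq_nonneg M)]
  linarith

/-- The quantitative hypotheses of the main estimate, `8M ≤ R_d`, `10³ ε_width R_d² ≤ M⁴`,
`10⁴ R_d² ≤ M⁴ ω²_high`, imply the cruder `10⁴ ε_width ≤ M²`, `10⁵ ≤ M² ω²_high` used for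
`|V| ≤ ω²/4`. [folklore] -/
theorem tdSmallness_aux (hM : 0 < M) (hRd : 8 * M ≤ Rd) (hε : 10 ^ 3 * ε * Rd ^ 2 ≤ M ^ 4)
    (hωh' : 10 ^ 4 * Rd ^ 2 ≤ M ^ 4 * ωh ^ 2) :
    10 ^ 4 * ε ≤ M ^ 2 ∧ 10 ^ 5 ≤ M ^ 2 * ωh ^ 2 := by
  have hRd2 : 64 * M ^ 2 ≤ Rd ^ 2 := by nlinarith
  have hM2 : 0 < M ^ 2 := by positivity
  constructor
  · rcases le_or_gt ε 0 with hε0 | hε0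
    · linarith [hM2]
    · -- `10⁴ ε M² ≤ 10³ ε (64 M²) ≤ 10³ ε R_d² ≤ M⁴`
      have h1 : 10 ^ 3 * ε * (64 * M ^ 2) ≤ 10 ^ 3 * ε * Rd ^ 2 :=
        mul_le_mul_of_nonneg_left hRd2 (by positivity)
      have h2 : 10 ^ 4 * ε * M ^ 2 ≤ M ^ 2 * M ^ 2 := by nlinarith
      exact le_of_mul_le_mul_right h2 hM2
  · have h1 : 10 ^ 4 * (64 * M ^ 2) ≤ 10 ^ 4 * Rd ^ 2 := by nlinarith
    have h2 : M ^ 2 * 10 ^ 5 ≤ M ^ 2 * (M ^ 2 * ωh ^ 2) := by nlinarith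
    exact le_of_mul_le_mul_left h2 hM2

/-- **Smallness of `dV/dr` in `𝓖_♯`**: for an admissible triple with `Λ ≤ ε ω²`, `ω_high ≤ |ω|`,
and `8M ≤ R_d`, `10³ ε R_d² ≤ M⁴`, `10⁴ R_d² ≤ M⁴ ω²_high`, one has `|dV/dr(r)| ≤ 3Mω²/(8R_d²)` on
`r ≥ r₊` (from `|dV/dr| ≤ 24Λ/r³ + 184M/r⁴`). DRSR arXiv:1402.7034, §8.4 ((someBoundS)).
[cite: DafermosRodnianskiShlapentokhrothman2014, Prop. 8.4.1 (proof)] -/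
theorem abs_deriv_sepPotential_le_small (hMa : IsSubextremal M a)
    (hadm : IsAdmissibleTriple a ω m Λ) (hΛ : Λ ≤ ε * ω ^ 2) (hωh0 : 0 ≤ ωh) (hωh : ωh ≤ |ω|)
    (hRd : 8 * M ≤ Rd) (hε : 10 ^ 3 * ε * Rd ^ 2 ≤ M ^ 4) (hωh' : 10 ^ 4 * Rd ^ 2 ≤ M ^ 4 * ωh ^ 2)
    {r : ℝ} (hr : rPlus M a ≤ r) :
    |deriv (sepPotential M a ω m Λ) r| ≤ 3 * M * ω ^ 2 / (8 * Rd ^ 2) := by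
  have hM := hMa.pos
  have hRd0 : 0 < Rd := by linarith
  have hMr : M ≤ r := (M_le_rPlus M a).trans hr
  have hr0 : 0 < r := hM.trans_le hMr
  have hΛ0 := hadm.nonneg
  have hω0 : 0 ≤ ω ^ 2 := sq_nonneg ω
  have hω2 : ωh ^ 2 ≤ ω ^ 2 := by
    calc ωh ^ 2 ≤ |ω| ^ 2 := pow_le_pow_left₀ hωh0 hωh 2
      _ = ω ^ 2 := sq_abs ω
  have h := abs_deriv_sepPotential_le hM (le_of_lt hMa) hadm hr
  have h1 : 24 * Λ / r ^ 3 ≤ 24 * Λ / M ^ 3 :=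
    div_le_div_of_nonneg_left (by positivity) (by positivity) (pow_le_pow_left₀ hM.le hMr 3)
  have h2 : 184 * M / r ^ 4 ≤ 184 * M / M ^ 4 :=
    div_le_div_of_nonneg_left (by positivity) (by positivity) (pow_le_pow_left₀ hM.le hMr 4)
  -- `10³ Λ R_d² ≤ M⁴ ω²` and `10⁴ R_d² ≤ M⁴ ω²`
  have hkey1 : 10 ^ 3 * Rd ^ 2 * Λ ≤ M ^ 4 * ω ^ 2 := by
    have e1 : 10 ^ 3 * Rd ^ 2 * Λ ≤ 10 ^ 3 * Rd ^ 2 * (ε * ω ^ 2) :=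
      mul_le_mul_of_nonneg_left hΛ (by positivity)
    nlinarith [mul_le_mul_of_nonneg_right hε hω0]
  have hkey2 : 10 ^ 4 * Rd ^ 2 ≤ M ^ 4 * ω ^ 2 :=
    hωh'.trans (mul_le_mul_of_nonneg_left hω2 (by positivity))
  -- `24Λ/M³ ≤ 24Mω²/(10³R_d²)`
  have h3 : 24 * Λ / M ^ 3 ≤ 24 * M * ω ^ 2 / (10 ^ 3 * Rd ^ 2) := by
    rw [div_le_div_iff₀ (by positivity) (by positivity)]
    nlinarith [mul_le_mul_of_nonneg_left hkey1 (by positivity : (0 : ℝ) ≤ 24)]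
  -- `184M/M⁴ ≤ 184Mω²/(10⁴R_d²)`
  have h4 : 184 * M / M ^ 4 ≤ 184 * M * ω ^ 2 / (10 ^ 4 * Rd ^ 2) := by
    rw [div_le_div_iff₀ (by positivity) (by positivity)]
    nlinarith [mul_le_mul_of_nonneg_left hkey2 (by positivity : (0 : ℝ) ≤ 184 * M)]
  -- `24/10³ + 184/10⁴ = 0.0424 ≤ 3/8`
  have h5 : 24 * M * ω ^ 2 / (10 ^ 3 * Rd ^ 2) + 184 * M * ω ^ 2 / (10 ^ 4 * Rd ^ 2) ≤
      3 * M * ω ^ 2 / (8 * Rd ^ 2) := by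
    have hq : 0 ≤ M * ω ^ 2 / Rd ^ 2 := by positivity
    have e1 : 24 * M * ω ^ 2 / (10 ^ 3 * Rd ^ 2) = 24 / 10 ^ 3 * (M * ω ^ 2 / Rd ^ 2) := by
      field_simp
    have e2 : 184 * M * ω ^ 2 / (10 ^ 4 * Rd ^ 2) = 184 / 10 ^ 4 * (M * ω ^ 2 / Rd ^ 2) := by
      field_simp
    have e3 : 3 * M * ω ^ 2 / (8 * Rd ^ 2) = 3 / 8 * (M * ω ^ 2 / Rd ^ 2) := by field_simp
    rw [e1, e2, e3]
    nlinarith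
  linarith

/-- **The sign of the `r`-bulk `B(r) = Y'(ω² − V) − Y dV/dr`** in `𝓖_♯`: `B ≥ 0` on `r > r₊`, and
`B ≥ 3Mω²/(8R_d²)` on `r₊ < r ≤ R_d − M`. On `r ≤ R_d − M` this is `Y' ≥ M/R_d²`, `|V| ≤ ω²/4`,
`|dV/dr| ≤ 3Mω²/(8R_d²)`, `Y ≤ 1`; on `r ≥ R_d − M ≥ 7M` it is (decrease) `dV/dr < 0` with `Y > 0`,
`Y' ≥ 0`, `V ≤ ω²`. DRSR arXiv:1402.7034, proof of Prop. 8.4.1 ("We conclude the integrand on the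
left hand side is non-negative and bounds from above the expression `b∫(|u'|² + (ω² + Λ)|u|²)`").
[cite: DafermosRodnianskiShlapentokhrothman2014, Prop. 8.4.1 (proof)] -/
theorem tdBulk_coeff_bounds (hMa : IsSubextremal M a) (hadm : IsAdmissibleTriple a ω m Λ)
    (hΛ : Λ ≤ ε * ω ^ 2) (hωh0 : 0 ≤ ωh) (hωh : ωh ≤ |ω|) (hRd : 8 * M ≤ Rd)
    (hε : 10 ^ 3 * ε * Rd ^ 2 ≤ M ^ 4) (hωh' : 10 ^ 4 * Rd ^ 2 ≤ M ^ 4 * ωh ^ 2)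
    {r : ℝ} (hr : rPlus M a < r) :
    0 ≤ tdWeightDeriv M a Rd r * (ω ^ 2 - sepPotential M a ω m Λ r) -
        tdWeight M a Rd r * deriv (sepPotential M a ω m Λ) r ∧
      (r ≤ Rd - M → 3 * M * ω ^ 2 / (8 * Rd ^ 2) ≤
        tdWeightDeriv M a Rd r * (ω ^ 2 - sepPotential M a ω m Λ r) -
          tdWeight M a Rd r * deriv (sepPotential M a ω m Λ) r) := by
  have hM := hMa.pos
  have hRd0 : 0 < Rd := by linarith
  obtain ⟨hε', hωh''⟩ := tdSmallness_aux hM hRd hε hωh'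
  have hV := abs_le.1 (abs_sepPotential_le_quarter hMa hadm hΛ hωh0 hωh hε' hωh'' hr.le)
  have hV' := abs_le.1 (abs_deriv_sepPotential_le_small hMa hadm hΛ hωh0 hωh hRd hε hωh' hr.le)
  have hY := tdWeight_mem_Icc hM hRd hr.le
  have hY'0 := tdWeightDeriv_nonneg M a Rd r
  have hω0 : 0 ≤ ω ^ 2 := sq_nonneg ω
  -- the quantitative bound on `r ≤ R_d − M`
  have hsmall : r ≤ Rd - M → 3 * M * ω ^ 2 / (8 * Rd ^ 2) ≤
      tdWeightDeriv M a Rd r * (ω ^ 2 - sepPotential M a ω m Λ r) -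
        tdWeight M a Rd r * deriv (sepPotential M a ω m Λ) r := fun h7 ↦ by
    have hY' := le_tdWeightDeriv (a := a) hM hRd h7
    -- `Y'(ω² − V) ≥ (M/R_d²)·(3ω²/4)` and `Y·V_r ≤ 3Mω²/(8R_d²)`
    have h1 : M / Rd ^ 2 * (3 * ω ^ 2 / 4) ≤
        tdWeightDeriv M a Rd r * (ω ^ 2 - sepPotential M a ω m Λ r) :=
      mul_le_mul hY' (by linarith) (by positivity) hY'0
    have h2 : tdWeight M a Rd r * deriv (sepPotential M a ω m Λ) r ≤
        1 * (3 * M * ω ^ 2 / (8 * Rd ^ 2)) := by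
      calc tdWeight M a Rd r * deriv (sepPotential M a ω m Λ) r
          ≤ tdWeight M a Rd r * (3 * M * ω ^ 2 / (8 * Rd ^ 2)) :=
            mul_le_mul_of_nonneg_left hV'.2 (by linarith [hY.1])
        _ ≤ 1 * (3 * M * ω ^ 2 / (8 * Rd ^ 2)) :=
            mul_le_mul_of_nonneg_right hY.2 (by positivity)
    have h3 : M / Rd ^ 2 * (3 * ω ^ 2 / 4) - 1 * (3 * M * ω ^ 2 / (8 * Rd ^ 2)) =
        3 * M * ω ^ 2 / (8 * Rd ^ 2) := by
      field_simp; ring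
    linarith
  refine ⟨?_, hsmall⟩
  rcases le_or_gt r (Rd - M) with h7 | h7
  · exact le_trans (by positivity) (hsmall h7)
  · -- `r > R_d − M ≥ 7M`: `dV/dr < 0`
    have hdec := deriv_sepPotential_neg_of_seven_mul_le (ω := ω) (Λ := Λ) (m := m) hMa hadm
      (by linarith : 7 * M ≤ r)
    have h1 : 0 ≤ tdWeightDeriv M a Rd r * (ω ^ 2 - sepPotential M a ω m Λ r) :=
      mul_nonneg hY'0 (by linarith)
    have h2 : tdWeight M a Rd r * deriv (sepPotential M a ω m Λ) r ≤ 0 :=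
      mul_nonpos_of_nonneg_of_nonpos (by linarith [hY.1]) hdec.le
    linarith

end Bulk

/-! ### Proposition 8.4.1 -/

section Main

variable {M a ω Λ ε ωh E Rd δ Atop Abot x₁ x₂ : ℝ} {m : ℤ} {R : ℝ → ℝ} {u u₁ u₂ H : ℝ → ℂ}

/-- **DRSR Proposition 8.4.1 (the `𝓖_♯` multiplier estimate), explicit form.** Let `|a| < M`, `R` a
tortoise radius function (`KerrTortoiseRadius.lean`; these exist, `exists_isTortoiseRadius`),
`R_d ≥ 8M` a decoupling radius, `(ω, m, Λ)` admissible with `ω_high ≤ |ω|`, `Λ ≤ ε_width ω²`,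
non-superradiant (`ω(ω − ω₊m) ≥ 0`), where `ε_width ≤ 1`, `10³ ε_width R_d² ≤ M⁴` and
`10⁴ R_d² ≤ M⁴ ω²_high` ("`ω_high`, `ε_width⁻¹` sufficiently big"), and let `E ≥ 2`. Let `u` be a
`C²` solution on `ℝ ∋ x = r*` of `u'' + (ω² − V(R))u = H` (`H` continuous, `Re(u'H̄)` and `Im(Hū)`
integrable) with the boundary conditions (eq:b+) `u' − iωu → 0`, `|u|² → A₊` at `+∞` and (eq:b−)
`u' + i(ω − ω₊m)u → 0`, `|u|² → A₋` at `−∞`. Then, with the weight `y = Y ∘ R` (`tdWeight M a R_d`;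
`½ ≤ y ≤ 1`, `y' ≥ 0`, `y(−∞) = ½`, `y = 1` for `R ≥ R_d`), for every `r*`-interval `[x₁, x₂]`
with `R(x₁) ≥ r₊ + δ` and `R(x₂) ≤ R_d − M` (`δ > 0`; in loc. cit. `[R*₋, R*₊]`, and one takes
`R_d ≥ max(8M, R₊ + M)`):
`(3Mδ²/(16R_d⁴)) ∫_{x₁}^{x₂} (|u'|² + (ω² + Λ)|u|²) dr* ≤ ∫_{−∞}^{∞} (−2y Re(u'H̄) + Eω Im(Hū)) dr*`.
[cite: DafermosRodnianskiShlapentokhrothman2014, Prop. 8.4.1] -/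
theorem timeDominated_estimate_kerr (hMa : IsSubextremal M a) (hR : IsTortoiseRadius M a R)
    (hRd : 8 * M ≤ Rd) (hadm : IsAdmissibleTriple a ω m Λ) (hωh0 : 0 ≤ ωh) (hωh : ωh ≤ |ω|)
    (hΛ : Λ ≤ ε * ω ^ 2) (hns : 0 ≤ ω * (ω - horizonAngularVelocity M a * m))
    (hε₁ : ε ≤ 1) (hε : 10 ^ 3 * ε * Rd ^ 2 ≤ M ^ 4) (hωh' : 10 ^ 4 * Rd ^ 2 ≤ M ^ 4 * ωh ^ 2)
    (hE : 2 ≤ E)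
    (hu : ∀ x, HasDerivAt u (u₁ x) x) (hu₁ : ∀ x, HasDerivAt u₁ (u₂ x) x)
    (hode : ∀ x, u₂ x + ((ω ^ 2 - sepPotential M a ω m Λ (R x) : ℝ) : ℂ) * u x = H x)
    (hH : Continuous H) (hS₁ : Integrable fun x ↦ ⟪H x, u₁ x⟫_ℝ)
    (hS₂ : Integrable fun x ↦ (H x * conj (u x)).im)
    (hb_top : Tendsto (fun x ↦ u₁ x - Complex.I * ω * u x) atTop (𝓝 0))
    (hb_bot : Tendsto (fun x ↦ u₁ x + Complex.I * (ω - horizonAngularVelocity M a * m) * u x)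
      atBot (𝓝 0))
    (hA_top : Tendsto (fun x ↦ ‖u x‖ ^ 2) atTop (𝓝 Atop))
    (hA_bot : Tendsto (fun x ↦ ‖u x‖ ^ 2) atBot (𝓝 Abot))
    (hδ : 0 < δ) (hx : x₁ ≤ x₂) (hx₁ : rPlus M a + δ ≤ R x₁) (hx₂ : R x₂ ≤ Rd - M) :
    3 * M * δ ^ 2 / (16 * Rd ^ 4) * ∫ x in x₁..x₂, (‖u₁ x‖ ^ 2 + (ω ^ 2 + Λ) * ‖u x‖ ^ 2) ≤
      ∫ x, (-(2 * tdWeight M a Rd (R x) * ⟪H x, u₁ x⟫_ℝ) + E * (ω * (H x * conj (u x)).im)) := by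
  have hM := hMa.pos
  have hRd0 : 0 < Rd := by linarith
  have hΛ0 := hadm.nonneg
  -- the data of the abstract estimate
  set V : ℝ → ℝ := fun x ↦ sepPotential M a ω m Λ (R x) with hVdef
  set V₁ : ℝ → ℝ := fun x ↦ deriv (sepPotential M a ω m Λ) (R x) *
    (delta M a (R x) / (R x ^ 2 + a ^ 2)) with hV₁def
  set y : ℝ → ℝ := fun x ↦ tdWeight M a Rd (R x) with hydef
  set y₁ : ℝ → ℝ := fun x ↦ tdWeightDeriv M a Rd (R x) * (delta M a (R x) / (R x ^ 2 + a ^ 2))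
    with hy₁def
  set ϖ : ℝ := ω - horizonAngularVelocity M a * m with hϖ
  have hV : ∀ x, HasDerivAt V (V₁ x) x := fun x ↦ hasDerivAt_sepPotential_comp hR hMa x
  have hy : ∀ x, HasDerivAt y (y₁ x) x := fun x ↦
    (hasDerivAt_tdWeight M a Rd (R x)).comp x (hR.hasDerivAt x)
  -- integrability of `y⟪H, u'⟫` from that of `⟪H, u'⟫` (`y` continuous with `|y| ≤ 1`)
  have hyc : Continuous y := (continuous_tdWeight M a Rd).comp hR.continuous
  have hS₁' : Integrable fun x ↦ y x * ⟪H x, u₁ x⟫_ℝ := by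
    refine hS₁.bdd_mul (c := 1) hyc.aestronglyMeasurable (Eventually.of_forall fun x ↦ ?_)
    have h := tdWeight_mem_Icc (a := a) hM hRd (hR.rPlus_lt x).le
    rw [Real.norm_eq_abs, abs_le]
    exact ⟨by linarith [h.1], h.2⟩
  -- limits of `V` and `y`
  have hV_top : Tendsto V atTop (𝓝 0) := tendsto_sepPotential_comp_atTop hR hMa hadm
  have hV_bot : Tendsto V atBot (𝓝 (ω ^ 2 - ϖ ^ 2)) := tendsto_sepPotential_comp_atBot hR hMa
  have hy_top : Tendsto y atTop (𝓝 1) := by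
    apply tendsto_const_nhds.congr'
    filter_upwards [hR.eventually_le Rd] with x hx
    exact (tdWeight_eq_one hx).symm
  have hy_bot : Tendsto y atBot (𝓝 (1 / 2)) := by
    have h := ((continuous_tdWeight M a Rd).tendsto (rPlus M a)).comp hR.tendsto_atBot
    rwa [tdWeight_rPlus hM hRd] at h
  -- the bulk, factorised
  have hbulk : ∀ x, koppaBulk ω V V₁ y y₁ u u₁ x =
      delta M a (R x) / (R x ^ 2 + a ^ 2) *
        (tdWeightDeriv M a Rd (R x) * ‖u₁ x‖ ^ 2 +
          (tdWeightDeriv M a Rd (R x) * (ω ^ 2 - sepPotential M a ω m Λ (R x)) -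
            tdWeight M a Rd (R x) * deriv (sepPotential M a ω m Λ) (R x)) * ‖u x‖ ^ 2) := by
    intro x
    simp only [koppaBulk, hVdef, hV₁def, hydef, hy₁def]
    ring
  have hP0 : ∀ x, 0 ≤ koppaBulk ω V V₁ y y₁ u u₁ x := fun x ↦ by
    rw [hbulk x]
    have h := (tdBulk_coeff_bounds hMa hadm hΛ hωh0 hωh hRd hε hωh' (hR.rPlus_lt x)).1
    have h' := tdWeightDeriv_nonneg M a Rd (R x)
    have hf := (hR.deriv_pos hMa x).le
    exact mul_nonneg hf (add_nonneg (mul_nonneg h' (sq_nonneg _)) (mul_nonneg h (sq_nonneg _)))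
  -- coercivity on `[x₁, x₂]`
  have hmono := (hR.strictMono hMa).monotone
  have hcoer : ∀ x ∈ Icc x₁ x₂, 3 * M * δ ^ 2 / (16 * Rd ^ 4) *
      (‖u₁ x‖ ^ 2 + (ω ^ 2 + Λ) * ‖u x‖ ^ 2) ≤ koppaBulk ω V V₁ y y₁ u u₁ x := by
    intro x hxI
    have hRx₁ : rPlus M a + δ ≤ R x := hx₁.trans (hmono hxI.1)
    have hRx₂ : R x ≤ Rd - M := (hmono hxI.2).trans hx₂
    have hr : rPlus M a < R x := by linarith
    obtain ⟨-, hB⟩ := tdBulk_coeff_bounds hMa hadm hΛ hωh0 hωh hRd hε hωh' hr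
    have hB := hB hRx₂
    have hY' := le_tdWeightDeriv (a := a) hM hRd hRx₂
    -- `Δ/(R² + a²) ≥ δ²/R_d²`
    have hfac : δ ^ 2 / Rd ^ 2 ≤ delta M a (R x) / (R x ^ 2 + a ^ 2) := by
      have hΔ : δ ^ 2 ≤ delta M a (R x) := by
        rw [delta_eq_mul (le_of_lt hMa)]
        have h1 : δ ≤ R x - rPlus M a := by linarith
        have h2 : δ ≤ R x - rMinus M a := by linarith [rMinus_le_rPlus M a]
        calc δ ^ 2 = δ * δ := by ring
          _ ≤ (R x - rPlus M a) * (R x - rMinus M a) := mul_le_mul h1 h2 hδ.le (by linarith)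
      have ha2 : a ^ 2 ≤ M ^ 2 := sq_le_sq' (abs_lt.1 hMa).1.le (abs_lt.1 hMa).2.le
      have hD : R x ^ 2 + a ^ 2 ≤ Rd ^ 2 := by
        have hR0 : 0 ≤ R x := (hR.pos hMa x).le
        have e1 : R x ^ 2 ≤ (Rd - M) ^ 2 := pow_le_pow_left₀ hR0 hRx₂ 2
        have e2 : M * M ≤ M * Rd := mul_le_mul_of_nonneg_left (by linarith) hM.le
        nlinarith [e1, e2, ha2]
      have hD0 : 0 < R x ^ 2 + a ^ 2 := hR.sq_add_sq_pos hMa x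
      calc δ ^ 2 / Rd ^ 2 ≤ δ ^ 2 / (R x ^ 2 + a ^ 2) :=
            div_le_div_of_nonneg_left (sq_nonneg δ) hD0 hD
        _ ≤ delta M a (R x) / (R x ^ 2 + a ^ 2) := by gcongr
    -- the bracket `≥ (3M/(16R_d²)) (|u'|² + (ω² + Λ)|u|²)`
    have hω0 : 0 ≤ ω ^ 2 := sq_nonneg ω
    have hΛω : Λ ≤ ω ^ 2 := hΛ.trans (by linarith [mul_le_mul_of_nonneg_right hε₁ hω0])
    have hbr : 3 * M / (16 * Rd ^ 2) * (‖u₁ x‖ ^ 2 + (ω ^ 2 + Λ) * ‖u x‖ ^ 2) ≤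
        tdWeightDeriv M a Rd (R x) * ‖u₁ x‖ ^ 2 +
          (tdWeightDeriv M a Rd (R x) * (ω ^ 2 - sepPotential M a ω m Λ (R x)) -
            tdWeight M a Rd (R x) * deriv (sepPotential M a ω m Λ) (R x)) * ‖u x‖ ^ 2 := by
      have hMR : 0 ≤ M * Rd ^ 2 := by positivity
      have h1 : 3 * M / (16 * Rd ^ 2) ≤ M / Rd ^ 2 := by
        rw [div_le_div_iff₀ (by positivity) (by positivity)]
        linarith [hMR]
      have h2 : 3 * M / (16 * Rd ^ 2) * (ω ^ 2 + Λ) ≤ 3 * M * ω ^ 2 / (8 * Rd ^ 2) := by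
        rw [div_mul_eq_mul_div, div_le_div_iff₀ (by positivity) (by positivity)]
        linarith [mul_le_mul_of_nonneg_right hΛω hMR]
      have hu1 : 0 ≤ ‖u₁ x‖ ^ 2 := sq_nonneg _
      have hu0 : 0 ≤ ‖u x‖ ^ 2 := sq_nonneg _
      linarith [mul_le_mul_of_nonneg_right (h1.trans hY') hu1,
        mul_le_mul_of_nonneg_right (h2.trans hB) hu0]
    rw [hbulk x]
    have hbr0 : 0 ≤ ‖u₁ x‖ ^ 2 + (ω ^ 2 + Λ) * ‖u x‖ ^ 2 := by positivity
    calc 3 * M * δ ^ 2 / (16 * Rd ^ 4) * (‖u₁ x‖ ^ 2 + (ω ^ 2 + Λ) * ‖u x‖ ^ 2)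
        = δ ^ 2 / Rd ^ 2 * (3 * M / (16 * Rd ^ 2) * (‖u₁ x‖ ^ 2 + (ω ^ 2 + Λ) * ‖u x‖ ^ 2)) := by
          field_simp
      _ ≤ delta M a (R x) / (R x ^ 2 + a ^ 2) *
            (tdWeightDeriv M a Rd (R x) * ‖u₁ x‖ ^ 2 +
              (tdWeightDeriv M a Rd (R x) * (ω ^ 2 - sepPotential M a ω m Λ (R x)) -
                tdWeight M a Rd (R x) * deriv (sepPotential M a ω m Λ) (R x)) * ‖u x‖ ^ 2) :=
          mul_le_mul hfac hbr (by positivity) (hR.deriv_pos hMa x).le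
  -- apply the abstract estimate
  have hb_bot' : Tendsto (fun x ↦ u₁ x + Complex.I * ϖ * u x) atBot (𝓝 0) := by
    simpa [hϖ] using hb_bot
  have h := timeDominated_estimate (E := E) (Λ := Λ) hV hy hu hu₁ hode hH hS₁' hS₂ hb_top hb_bot'
    hA_top hA_bot hV_top hV_bot hy_top hy_bot hE hns hP0 hx hcoer
  simpa [hydef] using h

end Main

end Kerr

end Literature.Geometry.Lorentzian

end
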